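import Mathlib
import Summits.ValiantsHypothesis.ValiantsHypothesis.Theorems.NewtonUnitEquationsTwoProductsDissocRecords
import Summits.ValiantsHypothesis.ValiantsHypothesis.Theorems.NewtonUnitEquationsTwoProductsDissocRecordCard
import Summits.ValiantsHypothesis.ValiantsHypothesis.Theorems.NewtonUnitEquationsTwoProductsDissocBridge
import Summits.ValiantsHypothesis.ValiantsHypothesis.Theorems.NewtonUnitEquationsTwoProductsDissocCount

/-! # Rung `stub_engineDissociated` — crux `TwoProducts` (stmt-ValiantsHypothesis-5906), line `corner-log-linearization`

THE DISSOCIATED ENGINE (lead c3; crux-shaped).  For local factors `u, v : Fin n → ℂ[X,Y]` with constant terms `1`, let `U` be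
the set of letters (nonzero support points of the `2n` factors, `s = |U|`).  The south-west vertices `e` of `∏u − ∏v` that admit
an exposing weight `w > 0` for which the exponent map `m ↦ Σ_a m_a • a` is injective on the multisets over `U` of `w`-weight
`≤ wt e` number at most `(s² + 2)·(2n)·4^{2n−1} = 2^{O(n)}·s²`.

Composition of the four landed pieces: the bridge (R3) turns such a vertex into a multiset `m*` with nonzero moment all of
whose weight-`≤` competitors are dead; the record lemma (R1) bounds `|m*| ≤ 2n − 1` and puts the letters of `m*` among the
greedy records of the letter columns in `w`-cost order; the records are `≤ 2n − 1` (R2) and depend only on the weak cost order,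
so the count (R4) applies with `d = 2n − 1`. [folklore] -/

set_option linter.dupNamespace false -- single-conjunct summit: `ValiantsHypothesis.ValiantsHypothesis`

namespace Summit.ValiantsHypothesis.ValiantsHypothesis.Theorems.TwoProducts.Dissociated

open scoped BigOperators
open MvPolynomial

variable {n : ℕ}

/-- The weight of `φ(m)` is the `m`-weighted sum of the letter weights. [folklore] -/
theorem wt_phi (w : Fin 2 → ℤ) (m : (Fin 2 →₀ ℕ) →₀ ℕ) :
    w 0 * ((m.sum fun a k => k • a) 0 : ℤ) + w 1 * ((m.sum fun a k => k • a) 1 : ℤ) =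
      m.sum fun a k => (k : ℤ) * (w 0 * (a 0 : ℤ) + w 1 * (a 1 : ℤ)) := by
  let ω : (Fin 2 →₀ ℕ) →+ ℤ :=
    { toFun := fun p => w 0 * (p 0 : ℤ) + w 1 * (p 1 : ℤ)
      map_zero' := by simp
      map_add' := fun p q => by
        simp only [Finsupp.coe_add, Pi.add_apply]
        push_cast
        ring }
  have hω : ∀ p : Fin 2 →₀ ℕ, ω p = w 0 * (p 0 : ℤ) + w 1 * (p 1 : ℤ) := fun p => rfl
  rw [← hω, map_finsuppSum]
  refine Finsupp.sum_congr fun a _ => ?_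
  rw [map_nsmul, hω, nsmul_eq_mul]

/-- Atoms: the coefficient vectors of the `2n` factors, `u`'s first. [folklore] -/
theorem sum_atoms (u v : Fin n → MvPolynomial (Fin 2) ℂ) (m : (Fin 2 →₀ ℕ) →₀ ℕ) :
    (∑ i : Fin (n + n), Fin.append (fun _ : Fin n => (1 : ℂ)) (fun _ : Fin n => (-1 : ℂ)) i *
        m.prod (fun a k => Fin.append (fun i a => coeff a (u i)) (fun i a => coeff a (v i)) i a ^ k)) =
      (∑ i, m.prod fun a k => (coeff a (u i)) ^ k) - ∑ i, m.prod fun a k => (coeff a (v i)) ^ k := by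
  rw [Fin.sum_univ_add]
  simp only [Fin.append_left, Fin.append_right, one_mul, neg_mul, Finset.sum_neg_distrib]
  ring

/-- **The dissociated engine** (rung, lead c3). [folklore] -/
theorem stub_engineDissociated : ∀ (n : ℕ) (u v : Fin n → MvPolynomial (Fin 2) ℂ),
    (∀ i, MvPolynomial.coeff 0 (u i) = 1) → (∀ i, MvPolynomial.coeff 0 (v i) = 1) →
    {e : Fin 2 →₀ ℕ | ∃ w : Fin 2 → ℤ, 0 < w 0 ∧ 0 < w 1 ∧
      (e ∈ (∏ i, u i - ∏ i, v i).support ∧ ∀ e' ∈ (∏ i, u i - ∏ i, v i).support, e' ≠ e →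
        w 0 * (e 0 : ℤ) + w 1 * (e 1 : ℤ) < w 0 * (e' 0 : ℤ) + w 1 * (e' 1 : ℤ)) ∧
      (∀ m m' : (Fin 2 →₀ ℕ) →₀ ℕ,
        m.support ⊆ (Finset.univ.biUnion fun i => (u i).support ∪ (v i).support).erase 0 →
        m'.support ⊆ (Finset.univ.biUnion fun i => (u i).support ∪ (v i).support).erase 0 →
        w 0 * ((m.sum fun a k => k • a) 0 : ℤ) + w 1 * ((m.sum fun a k => k • a) 1 : ℤ) ≤
          w 0 * (e 0 : ℤ) + w 1 * (e 1 : ℤ) →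
        (m.sum fun a k => k • a) = (m'.sum fun a k => k • a) → m = m')}.ncard
      ≤ (((Finset.univ.biUnion fun i => (u i).support ∪ (v i).support).erase 0).card ^ 2 + 2) *
          (2 * n * 4 ^ (2 * n - 1)) := by
  classical
  intro n u v hu hv
  -- the degenerate case `n = 0`: the difference of the empty products vanishes
  rcases Nat.eq_zero_or_pos n with hn | hn
  · subst hn
    have h0 : (∏ i : Fin 0, u i - ∏ i : Fin 0, v i) = 0 := by simp
    have hempty : {e : Fin 2 →₀ ℕ | ∃ w : Fin 2 → ℤ, 0 < w 0 ∧ 0 < w 1 ∧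
        (e ∈ (∏ i, u i - ∏ i, v i).support ∧ ∀ e' ∈ (∏ i, u i - ∏ i, v i).support, e' ≠ e →
          w 0 * (e 0 : ℤ) + w 1 * (e 1 : ℤ) < w 0 * (e' 0 : ℤ) + w 1 * (e' 1 : ℤ)) ∧
        (∀ m m' : (Fin 2 →₀ ℕ) →₀ ℕ,
          m.support ⊆ (Finset.univ.biUnion fun i => (u i).support ∪ (v i).support).erase 0 →
          m'.support ⊆ (Finset.univ.biUnion fun i => (u i).support ∪ (v i).support).erase 0 →
          w 0 * ((m.sum fun a k => k • a) 0 : ℤ) + w 1 * ((m.sum fun a k => k • a) 1 : ℤ) ≤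
            w 0 * (e 0 : ℤ) + w 1 * (e 1 : ℤ) →
          (m.sum fun a k => k • a) = (m'.sum fun a k => k • a) → m = m')} = (∅ : Set (Fin 2 →₀ ℕ)) := by
      refine Set.eq_empty_of_forall_notMem ?_
      rintro e ⟨w, -, -, ⟨he, -⟩, -⟩
      rw [h0, support_zero] at he
      exact absurd he (Finset.notMem_empty e)
    rw [hempty, Set.ncard_empty]
    exact Nat.zero_le _
  set U : Finset (Fin 2 →₀ ℕ) := (Finset.univ.biUnion fun i => (u i).support ∪ (v i).support).erase 0 with hUdef
  -- atoms, signs, letter weights, records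
  set N : ℕ := n + n with hN
  set c : Fin N → (Fin 2 →₀ ℕ) → ℂ := Fin.append (fun i a => coeff a (u i)) (fun i a => coeff a (v i)) with hc
  set lam : Fin N → ℂ := Fin.append (fun _ : Fin n => (1 : ℂ)) (fun _ : Fin n => (-1 : ℂ)) with hlam
  set wt : (Fin 2 → ℤ) → (Fin 2 →₀ ℕ) → ℤ := fun w p => w 0 * (p 0 : ℤ) + w 1 * (p 1 : ℤ) with hwt
  set Rw : (Fin 2 → ℤ) → Finset (Fin 2 →₀ ℕ) := fun w => U.filter fun a => (fun i => c i a) ∉ Submodule.span ℂ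
      (insert (fun _ : Fin N => (1 : ℂ)) ((fun b : Fin 2 →₀ ℕ => fun i : Fin N => c i b) ''
        {b : Fin 2 →₀ ℕ | b ∈ U ∧ b ≠ a ∧ wt w b ≤ wt w a})) with hRw
  have hRU : ∀ w, Rw w ⊆ U := fun w => Finset.filter_subset _ _
  have hRcard : ∀ w, (Rw w).card ≤ 2 * n - 1 := by
    intro w
    have h := DissocRecordCard.stub_dissocRecordCard N c U (wt w)
    have hset : ({a : Fin 2 →₀ ℕ | a ∈ U ∧ (fun i => c i a) ∉ Submodule.span ℂ
        (insert (fun _ : Fin N => (1 : ℂ)) ((fun b : Fin 2 →₀ ℕ => fun i : Fin N => c i b) ''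
          {b : Fin 2 →₀ ℕ | b ∈ U ∧ b ≠ a ∧ wt w b ≤ wt w a}))} : Set (Fin 2 →₀ ℕ)) = ↑(Rw w) := by
      ext a; simp [hRw]
    rw [hset, Set.ncard_coe_finset] at h
    simp only [hN] at h
    omega
  have hRinv : ∀ w w' : Fin 2 → ℤ,
      (∀ a ∈ U, ∀ b ∈ U, (w 0 * (b 0 : ℤ) + w 1 * (b 1 : ℤ) ≤ w 0 * (a 0 : ℤ) + w 1 * (a 1 : ℤ) ↔
        w' 0 * (b 0 : ℤ) + w' 1 * (b 1 : ℤ) ≤ w' 0 * (a 0 : ℤ) + w' 1 * (a 1 : ℤ))) → Rw w = Rw w' := by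
    intro w w' hrel
    simp only [hRw]
    refine Finset.filter_congr fun a ha => ?_
    have hS : {b : Fin 2 →₀ ℕ | b ∈ U ∧ b ≠ a ∧ wt w b ≤ wt w a} =
        {b : Fin 2 →₀ ℕ | b ∈ U ∧ b ≠ a ∧ wt w' b ≤ wt w' a} := by
      ext b
      simp only [Set.mem_setOf_eq]
      constructor
      · rintro ⟨hb, hba, hle⟩; exact ⟨hb, hba, (hrel a ha b hb).mp hle⟩
      · rintro ⟨hb, hba, hle⟩; exact ⟨hb, hba, (hrel a ha b hb).mpr hle⟩
    rw [hS]
  -- the count, at `d = 2n − 1`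
  have hcount := DissocCount.stub_dissocCount (2 * n - 1) U Rw hRU hRcard hRinv
  have hd : 2 * n - 1 + 1 = 2 * n := by omega
  rw [hd] at hcount
  refine le_trans (Set.ncard_le_ncard ?_ ?_) hcount
  · -- every dissociated vertex is `φ(m*)` for a small multiset of records
    rintro e ⟨w, hw0, hw1, hmin, hinj⟩
    refine ⟨w, hw0, hw1, ?_⟩
    obtain ⟨ms, hmsU, hmse, hμ, hdead⟩ := DissocBridge.stub_dissocBridge n u v hu hv w hw0 hw1 e hmin hinj
    -- hypotheses of the record lemma
    have hWnn : ∀ a ∈ U, 0 ≤ wt w a := fun a ha => by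
      have h0 : a ≠ 0 := by
        rw [hUdef] at ha
        exact (Finset.mem_erase.mp ha).1
      have := PowerSum.one_le_wt_of_ne_zero w hw0 hw1 a h0
      simp only [hwt]; linarith
    have hμ' : (∑ i, lam i * ms.prod (fun a k => c i a ^ k)) ≠ 0 := by
      rw [hc, hlam, sum_atoms u v ms]; exact hμ
    have hwms : (ms.sum fun a k => (k : ℤ) * wt w a) = wt w e := by
      rw [← hmse]; exact (wt_phi w ms).symm
    have hdead' : ∀ m : (Fin 2 →₀ ℕ) →₀ ℕ, m.support ⊆ U → m ≠ ms →
        (m.sum fun a k => (k : ℤ) * wt w a) ≤ (ms.sum fun a k => (k : ℤ) * wt w a) →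
        (∑ i, lam i * m.prod (fun a k => c i a ^ k)) = 0 := by
      intro m hmU hmne hle
      rw [hc, hlam, sum_atoms u v m]
      refine hdead m hmU hmne ?_
      rw [wt_phi w m]
      rw [hwms] at hle
      exact hle
    obtain ⟨hsize, hrec⟩ := DissocRecords.stub_dissocRecords N c lam U (wt w) ms hWnn hmsU hμ' hdead'
    refine ⟨ms, ?_, ?_, hmse⟩
    · intro a ha
      simp only [hRw, Finset.mem_filter]
      exact ⟨hmsU ha, hrec a ha⟩
    · simp only [hN] at hsize
      omega
  · -- finiteness of the comparison set: all its multisets lie in a box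
    refine Set.Finite.subset ((Finset.Iic (∑ a ∈ U, Finsupp.single a (2 * n - 1))).image
      (fun m : (Fin 2 →₀ ℕ) →₀ ℕ => m.sum fun a k => k • a)).finite_toSet ?_
    rintro e ⟨w, -, -, m, hmR, hdeg, hme⟩
    simp only [Finset.coe_image, Set.mem_image, Finset.mem_coe, Finset.mem_Iic]
    refine ⟨m, ?_, hme⟩
    intro a
    rw [Finsupp.finsetSum_apply]
    by_cases ha : a ∈ m.support
    · have haU : a ∈ U := hRU w (hmR ha)
      rw [Finset.sum_eq_single a (fun b _ hba => by rw [Finsupp.single_apply, if_neg hba])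
        (fun h => absurd haU h), Finsupp.single_eq_same]
      exact le_trans (Finsupp.le_degree a m) (by rw [Finsupp.degree_apply]; exact hdeg)
    · rw [Finsupp.notMem_support_iff.mp ha]
      exact Nat.zero_le _

end Summit.ValiantsHypothesis.ValiantsHypothesis.Theorems.TwoProducts.Dissociated
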